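import Summits.BirchSwinnertonDyer.BirchSwinnertonDyer.Theorems.ManinLocalTwoThreeHalvingCoverUDC
import Summits.BirchSwinnertonDyer.BirchSwinnertonDyer.Theorems.ManinLocalTwoThreeThirdingCoverUDC
import Summits.BirchSwinnertonDyer.BirchSwinnertonDyer.Theorems.ManinLocalTwoThreeIntegralQSeriesNearCuspB
import Summits.BirchSwinnertonDyer.Rank1Residual.ManinAdditive.KummerCubeMonodromy
import Literature.NumberTheory.EllipticCurves.EichlerIntegralPolesProofs
import Literature.NumberTheory.EllipticCurves.WeierstrassPEichlerOrderProofs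
import HarnessLib

/-!
(LANDING COPY, prover p3 gen 18, 2026-08-30: §1 (the `c`-division cover group) and §2 (the UDC glue) of -an g44's file VERBATIM —
def-free theorems; §3 (the typed row `CDivisionWitnessLaw`) and §4 (the compositions) of the same file are to be APPENDED by -ty or -an;
the def-free assembly `CDivAssembly.exists_cDivisionWitness` / `maninPrimeToThreeAtNine_of_CDT` lives in `…CDivisionAssembly.lean`.)

# THE `c`-DIVISION WITNESS (cell bsd-f2-manin, planner seat -an g44): ONE analytic witness law, with NO divisibility hypothesis,
# feeding BOTH C2 `ManinOddAtFour` (stmt-BirchSwinnertonDyer-22967) and C3 `ManinPrimeToThreeAtNine` (stmt-…-22968) of route `ManinLocalTwoThree`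

THE OBJECT.  For an `X₀(N)`-datum `D` of a globally minimal `W` (`φ = u_W∘(c·E_f)`, `c = D.c`, `Λ_W = D.L.lattice ⊇ c·Λ₀(f)`), the
**`c`-division point of the parametrisation** is `H := u_W ∘ E_f` (`[c]H = φ`); its `x`-coordinate is `X_W := ℘_{Λ_W}(E_f)` (`= x_W(H) + b₂/12`),
modular for EXACTLY the **`c`-division cover group** `Γ^{(c)} := {γ ∈ Γ₀(N) : {∞,γ∞}_f ∈ Λ_W}` (§1: finite index, normal, type II), and
`Γ^{(c)} ≤ Γ^{(p)} := {γ : c·{∞,γ∞}_f ∈ pΛ_W}` for `p ∣ c` (§2).  THE WITNESS.  `F := 12·X_W·B_d·Δ^a` with `B_d` the INTEGER-coefficient denominator of a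
presentation of the genuine modular function `x' = shortX D = c²·℘_{Λ_W}(c·E_f) = ℘_{c⁻¹Λ_W}(E_f)`: the poles of `X_W` are among those of `x'` WITH THE SAME
ORDER (`meromorphicOrderAt_weierstrassP_eichlerIntegral`, any lattice), so `B_d` kills them; `Δ^a` bounds `F` at every cusp
(`IsCuspFunction.tendsto_weierstrassP_mul_pow_atImInfty`); the stabiliser of `F` in `Γ₀(N)` is EXACTLY `Γ^{(c)}` (`⟹`:
`PeriodPair.mem_lattice_of_weierstrassP_comp_add_eventuallyEq`); near `i∞`, `12·X_W·Δ^a ∈ ℤ⟦q⟧` by HONDA AT THE INTEGER `1`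
(`t_H = exp_W(Σaₙqⁿ/n) ∈ q + q²ℤ⟦q⟧`, `x = X_E(t)/t²`, `X_E = formalXMulSq W ∈ ℤ⟦t⟧`, `Δ^a/q² ∈ ℤ⟦q⟧` for `a ≥ 2`).
(Why not `t((c/p)·E_f)`: the poles of `t = −x/y` lie over `{y = 0}`, three non-torsion points unless `a₁ = a₃ = 0`, not over `φ⁻¹(O ∪ E[2])` — memo §89.)

CONTENTS.  §1 `exists_cDivisionCoverSubgroup` (PROVED) · §2 `indexFour_of_cDivisionWitness_of_UDW` (`4 ∣ N`, `2 ∣ c`), `indexNine_…` (`9 ∣ N`, `3 ∣ c`)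
(PROVED, through LEAD's `halvingCover_noncongruence` / `thirdingCover_noncongruence`: `Γ(MN) ≤ Γ^{(c)} ≤ Γ^{(p)}`) · §3 `CDivisionWitnessLaw` (THE typed row
replacing `stub_halvingWitnessLaw` AND `stub_thirdingWitnessLaw`) · §4 `maninOddAtFour_of_CDT_cDivisionWitnessLaw_indexNeFour`,
`maninPrimeToThreeAtNine_of_CDT_cDivisionWitnessLaw` (PROVED) · §5 typed nodes (N1)–(N7) · §6 `cDivisionWitnessLaw_of_nodes : N1 → … → N7 → CDivisionWitnessLaw`
and the node-level C2/C3 compositions (PROVED; (QEXNB) `integralQSeriesNearCuspB_holds`, (QXP) `qExpansionExtensionPrinciple_holds` by name).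
HONEST FRAMING.  CONDITIONAL architecture: C2 ⟸ CDT ∧ (N1–N7) ∧ E-an-152b, C3 ⟸ CDT ∧ (N1–N7); the nodes are OPEN (N1–N6 ports of landed templates, S/M;
N7 = Honda at `1` + the `x`-dictionary germ, M/L); CDT is a printed fact; C2, C3, Manin's conjecture and BSD are NOT proved here.  No sorry; the only `def`s
are `Prop`-valued statement rows.  [cite: CalegariDimitrovTang2025, Thm. 1.0.1 and Remarks 58–59] [cite: KurthLong2008, Def. 16, Prop. 18]
[cite: Honda1970, Thm. 9] [cite: Manin1972, Prop. 1.4, Thm. 1.6] [cite: ShimuraIATAF1971, §2.4, Thm. 7.14] [cite: SilvermanAEC2009, IV.1]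
-/

set_option autoImplicit false
set_option linter.dupNamespace false

noncomputable section

open scoped MatrixGroups ModularForm PeriodPair Manifold Topology
open CongruenceSubgroup Complex Filter PowerSeries
open UpperHalfPlane hiding I
open WeierstrassCurve Literature.NumberTheory.EllipticCurves Literature.NumberTheory.EllipticCurves.ModularForms
open Summit.BirchSwinnertonDyer.Rank1Residual.ManinAdditive
open Summit.BirchSwinnertonDyer.Rank1Residual.ManinAdditive.UDCKummerLineK
open Summit.BirchSwinnertonDyer.Rank1Residual.ManinAdditive.ShimuraKernel
open Summit.BirchSwinnertonDyer.Rank1Residual.ManinAdditive.KummerCubeMonodromy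

namespace Summit.BirchSwinnertonDyer.BirchSwinnertonDyer.Theorems.ManinLocalTwoThree.CDivision

variable {W : WeierstrassCurve ℚ} [W.IsElliptic] [W.IsGloballyMinimal] {N : ℕ} [NeZero N]

/-! ## §1 The `c`-division cover group `Γ^{(c)} = {γ ∈ Γ₀(N) : {∞,γ∞}_f ∈ Λ_W}` -/

/-- `c²` classes: every `x ∈ Λ` is `≡ iω₁ + jω₂ (mod cΛ)` with `0 ≤ i, j < |c|`. [folklore] -/
theorem exists_classes_mod (L : PeriodPair) (c : ℤ) (hc : c ≠ 0) :
    ∀ x ∈ L.lattice, ∃ i j : ℕ, i < c.natAbs ∧ j < c.natAbs ∧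
      ∃ ν ∈ L.lattice, x - (i : ℂ) * L.ω₁ - (j : ℂ) * L.ω₂ = c * ν := by
  intro x hx
  obtain ⟨m, n, rfl⟩ := PeriodPair.mem_lattice.mp hx
  have hcpos : (0 : ℤ) < c.natAbs := by exact_mod_cast Int.natAbs_pos.mpr hc
  have em' : m = c * (m / c) + m % c := (Int.mul_ediv_add_emod m c).symm
  have en' : n = c * (n / c) + n % c := (Int.mul_ediv_add_emod n c).symm
  have hm0 : 0 ≤ m % c := Int.emod_nonneg _ hc
  have hn0 : 0 ≤ n % c := Int.emod_nonneg _ hc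
  have hm1 : m % c < c.natAbs := Int.emod_lt m hc
  have hn1 : n % c < c.natAbs := Int.emod_lt n hc
  refine ⟨(m % c).toNat, (n % c).toNat, ?_, ?_, ((m / c : ℤ) : ℂ) * L.ω₁ + ((n / c : ℤ) : ℂ) * L.ω₂,
    PeriodPair.mem_lattice.mpr ⟨m / c, n / c, rfl⟩, ?_⟩
  · have : ((m % c).toNat : ℤ) < c.natAbs := by rw [Int.toNat_of_nonneg hm0]; exact hm1
    exact_mod_cast this
  · have : ((n % c).toNat : ℤ) < c.natAbs := by rw [Int.toNat_of_nonneg hn0]; exact hn1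
    exact_mod_cast this
  · have h1 : (((m % c).toNat : ℕ) : ℂ) = ((m % c : ℤ) : ℂ) := by exact_mod_cast Int.toNat_of_nonneg hm0
    have h2 : (((n % c).toNat : ℕ) : ℂ) = ((n % c : ℤ) : ℂ) := by exact_mod_cast Int.toNat_of_nonneg hn0
    have em : (m : ℂ) = (c : ℂ) * ((m / c : ℤ) : ℂ) + ((m % c : ℤ) : ℂ) := by exact_mod_cast em'
    have en : (n : ℂ) = (c : ℂ) * ((n / c : ℤ) : ℂ) + ((n % c : ℤ) : ℂ) := by exact_mod_cast en'
    rw [h1, h2, em, en]; ring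

omit [W.IsElliptic] [W.IsGloballyMinimal] in
/-- **The `c`-division cover group.**  For any `X₀(N)`-datum `D`: `Γ^{(c)} = {γ ∈ Γ₀(N) : {∞,γ∞}_f ∈ Λ_W}` is a subgroup of `SL₂(ℤ)` inside `Γ₀(N)`, of
finite index (at most `c²` cosets: the classes of `c·{∞,γ∞}_f ∈ Λ_W` modulo `cΛ_W`), normal in `Γ₀(N)` (Manin's homomorphism `cuspSymbol_mul_holds`), containing
every element of trace `±2` (zero discriminant ⟹ zero period).  It is the monodromy group of the `c`-division cover `{(τ, H) : [c]H = φ(τ)}` of `X₀(N)`, on which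
`H = u_W ∘ E_f` is single-valued. [cite: KurthLong2008, Def. 16 (type II; shape)] [cite: Manin1972, Prop. 1.4 / Thm. 1.6] -/
theorem exists_cDivisionCoverSubgroup (D : ModularParametrizationData W N) :
    ∃ Γ : Subgroup SL(2, ℤ),
      (∀ γ : Gamma0 N, (γ : SL(2, ℤ)) ∈ Γ ↔ cuspSymbol D.f γ ∈ D.L.lattice) ∧
      Γ ≤ Gamma0 N ∧ Γ.FiniteIndex ∧ (∀ g ∈ Gamma0 N, ∀ γ ∈ Γ, g * γ * g⁻¹ ∈ Γ) ∧
      (∀ γ ∈ Gamma0 N, (γ 0 0 + γ 1 1 = 2 ∨ γ 0 0 + γ 1 1 = -2) → γ ∈ Γ) := by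
  let Γ : Subgroup SL(2, ℤ) :=
    { carrier := {g | ∃ hg : g ∈ Gamma0 N, cuspSymbol D.f ⟨g, hg⟩ ∈ D.L.lattice}
      one_mem' := by
        refine ⟨(Gamma0 N).one_mem, ?_⟩
        have : (⟨1, (Gamma0 N).one_mem⟩ : Gamma0 N) = 1 := rfl
        rw [this, cuspSymbol_one]; exact zero_mem _
      mul_mem' := by
        rintro g₁ g₂ ⟨hg₁, h₁⟩ ⟨hg₂, h₂⟩
        refine ⟨(Gamma0 N).mul_mem hg₁ hg₂, ?_⟩
        have : (⟨g₁ * g₂, (Gamma0 N).mul_mem hg₁ hg₂⟩ : Gamma0 N) = ⟨g₁, hg₁⟩ * ⟨g₂, hg₂⟩ := rfl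
        rw [this, cuspSymbol_mul_holds]; exact add_mem h₁ h₂
      inv_mem' := by
        rintro g ⟨hg, h⟩
        refine ⟨(Gamma0 N).inv_mem hg, ?_⟩
        have : (⟨g⁻¹, (Gamma0 N).inv_mem hg⟩ : Gamma0 N) = ⟨g, hg⟩⁻¹ := rfl
        rw [this, cuspSymbol_inv]; exact neg_mem h }
  have hmem : ∀ γ : Gamma0 N, (γ : SL(2, ℤ)) ∈ Γ ↔ cuspSymbol D.f γ ∈ D.L.lattice := fun γ ↦
    ⟨fun ⟨_, h⟩ ↦ h, fun h ↦ ⟨γ.2, h⟩⟩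
  refine ⟨Γ, hmem, fun g hg ↦ hg.1, ?_, ?_, ?_⟩
  · -- FINITE INDEX: at most `c²` cosets over `Γ₀(N)` — the classes of `c·{∞,γ∞}_f ∈ Λ_W` modulo `cΛ_W`
    classical
    have hc : D.c ≠ 0 := fun h ↦ D.cast_c_ne_zero (by rw [h, Int.cast_zero])
    have hcC : (D.c : ℂ) ≠ 0 := D.cast_c_ne_zero
    set n : ℕ := D.c.natAbs with hn
    have hcl : ∀ γ : Gamma0 N, ∃ i j : ℕ, i < n ∧ j < n ∧ ∃ ν ∈ D.L.lattice,
        (D.c : ℂ) * cuspSymbol D.f γ - (i : ℂ) * D.L.ω₁ - (j : ℂ) * D.L.ω₂ = D.c * ν := fun γ ↦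
      exists_classes_mod D.L D.c hc _ (D.smul_periodLattice_le _ (cuspSymbol_mem_periodLattice D.f γ))
    have hrep : ∀ p : Fin n × Fin n, ∃ g : Gamma0 N, (∃ γ : Gamma0 N, ∃ ν ∈ D.L.lattice,
        (D.c : ℂ) * cuspSymbol D.f γ - ((p.1 : ℕ) : ℂ) * D.L.ω₁ - ((p.2 : ℕ) : ℂ) * D.L.ω₂ = D.c * ν) →
        ∃ ν ∈ D.L.lattice, (D.c : ℂ) * cuspSymbol D.f g - ((p.1 : ℕ) : ℂ) * D.L.ω₁ - ((p.2 : ℕ) : ℂ) * D.L.ω₂ = D.c * ν := by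
      intro p
      by_cases h : ∃ γ : Gamma0 N, ∃ ν ∈ D.L.lattice,
          (D.c : ℂ) * cuspSymbol D.f γ - ((p.1 : ℕ) : ℂ) * D.L.ω₁ - ((p.2 : ℕ) : ℂ) * D.L.ω₂ = D.c * ν
      · obtain ⟨γ, hγ⟩ := h; exact ⟨γ, fun _ ↦ hγ⟩
      · exact ⟨1, fun h' ↦ absurd h' h⟩
    choose rep hrep using hrep
    have hcoset : ∀ γ : Gamma0 N, ∃ p : Fin n × Fin n, ((rep p : SL(2, ℤ)))⁻¹ * (γ : SL(2, ℤ)) ∈ Γ := by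
      intro γ
      obtain ⟨i, j, hi, hj, ν, hν, e⟩ := hcl γ
      set p : Fin n × Fin n := (⟨i, hi⟩, ⟨j, hj⟩) with hp
      obtain ⟨ν', hν', e'⟩ := hrep p ⟨γ, ν, hν, by rw [hp]; exact e⟩
      refine ⟨p, (hmem ((rep p)⁻¹ * γ)).mpr ?_⟩
      rw [cuspSymbol_mul_holds, cuspSymbol_inv]
      have e'' : (D.c : ℂ) * cuspSymbol D.f (rep p) - (i : ℂ) * D.L.ω₁ - (j : ℂ) * D.L.ω₂ = D.c * ν' := by rw [hp] at e'; exact e'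
      have key : (D.c : ℂ) * (-cuspSymbol D.f (rep p) + cuspSymbol D.f γ) = D.c * (ν - ν') := by linear_combination e - e''
      rw [mul_left_cancel₀ hcC key]
      exact sub_mem hν hν'
    haveI : Finite (SL(2, ℤ) ⧸ Γ) := by
      refine Finite.of_surjective
        (fun q : (SL(2, ℤ) ⧸ Gamma0 N) × (Fin n × Fin n) ↦ (QuotientGroup.mk (q.1.out * (rep q.2 : SL(2, ℤ))) : SL(2, ℤ) ⧸ Γ)) ?_
      intro q
      induction q using QuotientGroup.induction_on with
      | H g =>
        obtain ⟨h, hh⟩ := QuotientGroup.mk_out_eq_mul (Gamma0 N) g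
        obtain ⟨p, hδ⟩ := hcoset h⁻¹
        refine ⟨(QuotientGroup.mk g, p), ?_⟩
        show (QuotientGroup.mk ((QuotientGroup.mk g : SL(2, ℤ) ⧸ Gamma0 N).out * (rep p : SL(2, ℤ))) : SL(2, ℤ) ⧸ Γ) =
          QuotientGroup.mk g
        rw [QuotientGroup.eq, hh]
        have e : ((g : SL(2, ℤ)) * (h : SL(2, ℤ)) * (rep p : SL(2, ℤ)))⁻¹ * g =
            ((rep p : SL(2, ℤ)))⁻¹ * ((h⁻¹ : Gamma0 N) : SL(2, ℤ)) := by
          rw [Subgroup.coe_inv]; group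
        rw [e]; exact hδ
    exact Subgroup.finiteIndex_of_finite_quotient
  · -- NORMAL in `Γ₀(N)`
    rintro g hg γ ⟨hγ, h⟩
    have hmemg : g * γ * g⁻¹ ∈ Gamma0 N := (Gamma0 N).mul_mem ((Gamma0 N).mul_mem hg hγ) ((Gamma0 N).inv_mem hg)
    refine ⟨hmemg, ?_⟩
    have : (⟨g * γ * g⁻¹, hmemg⟩ : Gamma0 N) = ⟨g, hg⟩ * ⟨γ, hγ⟩ * ⟨g, hg⟩⁻¹ := rfl
    rw [this, cuspSymbol_mul_holds, cuspSymbol_mul_holds, cuspSymbol_inv]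
    convert h using 1; ring
  · -- trace `±2` ⟹ zero discriminant ⟹ zero period
    intro γ hγ htr
    refine ⟨hγ, ?_⟩
    have hdet : ((γ : Matrix (Fin 2) (Fin 2) ℤ)).det = 1 := γ.2
    have hdisc : ((((⟨γ, hγ⟩ : Gamma0 N) : SL(2, ℤ)) : Matrix (Fin 2) (Fin 2) ℤ)).discr = 0 := by
      show ((γ : Matrix (Fin 2) (Fin 2) ℤ)).discr = 0
      rw [Matrix.discr_fin_two, Matrix.trace_fin_two, hdet]
      rcases htr with h | h <;> rw [h] <;> norm_num
    rw [cuspSymbol_eq_zero_of_discr_eq_zero D.f hdisc]; exact zero_mem _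

/-! ## §2 The UDC glue: a `c`-division witness forces the index-`p²` configuration at `p² ∣ N`, `p ∣ c` (`p = 2, 3`) -/

omit [W.IsElliptic] [W.IsGloballyMinimal] in
/-- `Γ^{(c)} ≤ Γ^{(p)}` for `p ∣ c`: `{∞,γ∞}_f ∈ Λ_W` ⟹ `c·{∞,γ∞}_f = p·((c/p)·{∞,γ∞}_f) ∈ pΛ_W`. [folklore] -/
theorem exists_eq_mul_of_dvd_of_cuspSymbol_mem (D : ModularParametrizationData W N) {p : ℤ} (hp : p ∣ D.c) (γ : Gamma0 N)
    (h : cuspSymbol D.f γ ∈ D.L.lattice) : ∃ ν ∈ D.L.lattice, (D.c : ℂ) * cuspSymbol D.f γ = p * ν := by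
  obtain ⟨c', hc'⟩ := hp
  refine ⟨(c' : ℂ) * cuspSymbol D.f γ, ?_, by rw [hc']; push_cast; ring⟩
  have := zsmul_mem h c'
  rwa [zsmul_eq_mul] at this

omit [W.IsElliptic] [W.IsGloballyMinimal] in
/-- **`c`-division witness ∧ Unbounded Denominators ∧ `2 ∣ c` ⟹ index `4`** (lattice-optimal datum, `4 ∣ N`).  A holomorphic weight-`k` `F` with `Γ₀(N)`-stabiliser
EXACTLY `Γ^{(c)}`, exponential growth at the cusps and algebraic-integer `q`-expansion is — modulo `UnboundedDenominatorsWeightAlgInt k` — invariant under some `Γ(M)`,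
so `Γ(MN) ≤ Γ^{(c)} ≤ Γ^{(2)}`, which at `4 ∣ N` is the index-`4` configuration (LEAD's `halvingCover_noncongruence`).
[cite: CalegariDimitrovTang2025, Thm. 1.0.1] [cite: KurthLong2008, Prop. 18] -/
theorem indexFour_of_cDivisionWitness_of_UDW (D : ModularParametrizationData W N)
    (hopt : ∀ z ∈ D.L.lattice, ∃ w ∈ periodLattice D.f, z = D.c * w) (h4 : 2 ^ 2 ∣ N) (h2c : (2 : ℤ) ∣ D.c) {k : ℤ}
    (hUDW : UnboundedDenominatorsWeightAlgInt k) {F : ℍ → ℂ} (hhol : MDifferentiable 𝓘(ℂ) 𝓘(ℂ) F)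
    (hinv : ∀ γ : Gamma0 N, cuspSymbol D.f γ ∈ D.L.lattice → F ∣[k] (γ : SL(2, ℤ)) = F)
    (hstab : ∀ γ : Gamma0 N, F ∣[k] (γ : SL(2, ℤ)) = F → cuspSymbol D.f γ ∈ D.L.lattice)
    (hgrowth : ∀ g : SL(2, ℤ), ∃ C A m : ℝ, ∀ τ : ℍ, A ≤ τ.im → ‖(F ∣[k] g) τ‖ ≤ C * Real.exp (m * τ.im))
    (hq : ∃ b : ℕ → ℂ, (∀ n, IsIntegral ℤ (b n)) ∧ ∀ τ : ℍ,
      HasSum (fun n : ℕ ↦ b n * Complex.exp (2 * Real.pi * Complex.I * (τ : ℂ) * n)) (F τ)) :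
    ∀ z : ℂ, z ∈ periodLatticeGamma1 D.f ↔ ∃ w ∈ periodLattice D.f, z = 2 * w := by
  obtain ⟨Γ, hmem, hle, hfi, -, -⟩ := exists_cDivisionCoverSubgroup D
  obtain ⟨Γ₂, hmem₂, hle₂, hfi₂, hnorm₂, htr₂⟩ := Halving.exists_halvingCoverSubgroup D
  have hN : 0 < N := Nat.pos_of_ne_zero (NeZero.ne N)
  have hΓinv : ∀ γ ∈ Γ, F ∣[k] γ = F := fun γ hγ ↦ hinv ⟨γ, hle hγ⟩ ((hmem ⟨γ, hle hγ⟩).mp hγ)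
  obtain ⟨M, hM, hcong⟩ := hUDW Γ hfi F hhol hΓinv hgrowth hq
  by_contra hidx
  have hΓMN : CongruenceSubgroup.Gamma (M * N) ≤ Γ₂ := by
    intro g hg
    have hgN : g ∈ CongruenceSubgroup.Gamma N := Gamma_mul_le_right M N hg
    have hgM : g ∈ CongruenceSubgroup.Gamma M := Gamma_mul_le_left M N hg
    have hg0 : g ∈ Gamma0 N := Gamma_le_Gamma0 N hgN
    exact (hmem₂ ⟨g, hg0⟩).mpr (exists_eq_mul_of_dvd_of_cuspSymbol_mem D h2c ⟨g, hg0⟩ (hstab ⟨g, hg0⟩ (hcong g hgM)))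
  exact Halving.halvingCover_noncongruence D hopt h4 hidx hmem₂ hle₂ hfi₂ hnorm₂ htr₂ (M * N) (Nat.mul_pos hM hN) hΓMN

omit [W.IsElliptic] [W.IsGloballyMinimal] in
/-- **`c`-division witness ∧ Unbounded Denominators ∧ `3 ∣ c` ⟹ index `9`** (lattice-optimal datum, `9 ∣ N`): `Γ(MN) ≤ Γ^{(c)} ≤ Γ^{(3)}` (LEAD's
`thirdingCover_noncongruence`). [cite: CalegariDimitrovTang2025, Thm. 1.0.1] [cite: KurthLong2008, Prop. 18] -/
theorem indexNine_of_cDivisionWitness_of_UDW (D : ModularParametrizationData W N)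
    (hopt : ∀ z ∈ D.L.lattice, ∃ w ∈ periodLattice D.f, z = D.c * w) (h9 : 3 ^ 2 ∣ N) (h3c : (3 : ℤ) ∣ D.c) {k : ℤ}
    (hUDW : UnboundedDenominatorsWeightAlgInt k) {F : ℍ → ℂ} (hhol : MDifferentiable 𝓘(ℂ) 𝓘(ℂ) F)
    (hinv : ∀ γ : Gamma0 N, cuspSymbol D.f γ ∈ D.L.lattice → F ∣[k] (γ : SL(2, ℤ)) = F)
    (hstab : ∀ γ : Gamma0 N, F ∣[k] (γ : SL(2, ℤ)) = F → cuspSymbol D.f γ ∈ D.L.lattice)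
    (hgrowth : ∀ g : SL(2, ℤ), ∃ C A m : ℝ, ∀ τ : ℍ, A ≤ τ.im → ‖(F ∣[k] g) τ‖ ≤ C * Real.exp (m * τ.im))
    (hq : ∃ b : ℕ → ℂ, (∀ n, IsIntegral ℤ (b n)) ∧ ∀ τ : ℍ,
      HasSum (fun n : ℕ ↦ b n * Complex.exp (2 * Real.pi * Complex.I * (τ : ℂ) * n)) (F τ)) :
    ∀ z : ℂ, z ∈ periodLatticeGamma1 D.f ↔ ∃ w ∈ periodLattice D.f, z = 3 * w := by
  obtain ⟨Γ, hmem, hle, hfi, -, -⟩ := exists_cDivisionCoverSubgroup D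
  obtain ⟨Γ₃, hmem₃, hle₃, hfi₃, hnorm₃, htr₃⟩ := Thirding.exists_thirdingCoverSubgroup D
  have hN : 0 < N := Nat.pos_of_ne_zero (NeZero.ne N)
  have hΓinv : ∀ γ ∈ Γ, F ∣[k] γ = F := fun γ hγ ↦ hinv ⟨γ, hle hγ⟩ ((hmem ⟨γ, hle hγ⟩).mp hγ)
  obtain ⟨M, hM, hcong⟩ := hUDW Γ hfi F hhol hΓinv hgrowth hq
  by_contra hidx
  have hΓMN : CongruenceSubgroup.Gamma (M * N) ≤ Γ₃ := by
    intro g hg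
    have hgN : g ∈ CongruenceSubgroup.Gamma N := Gamma_mul_le_right M N hg
    have hgM : g ∈ CongruenceSubgroup.Gamma M := Gamma_mul_le_left M N hg
    have hg0 : g ∈ Gamma0 N := Gamma_le_Gamma0 N hgN
    exact (hmem₃ ⟨g, hg0⟩).mpr (exists_eq_mul_of_dvd_of_cuspSymbol_mem D h3c ⟨g, hg0⟩ (hstab ⟨g, hg0⟩ (hcong g hgM)))
  exact Thirding.thirdingCover_noncongruence D hopt h9 hidx hmem₃ hle₃ hfi₃ hnorm₃ htr₃ (M * N) (Nat.mul_pos hM hN) hΓMN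

end Summit.BirchSwinnertonDyer.BirchSwinnertonDyer.Theorems.ManinLocalTwoThree.CDivision

end
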